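import Literature.NumberTheory.DiophantineGeometry.GenEllDeFamilyBadPrimesConverse
import Literature.NumberTheory.DiophantineGeometry.GenEllDeFamilySlopeOffBadPrimes
import Literature.NumberTheory.DiophantineGeometry.GenEllDeCriticalValuesFamilyField
import HarnessLib

/-!
# [GenEll] Thm. 2.1 on the `D_e` route, family `t_c`: the converse and the conductor slope with the
# critical-value inputs DISCHARGED at `A := critSetC`

S. Mochizuki, *Arithmetic elliptic curves in general position*, Math. J. Okayama Univ. **52** (2010),
Prop. 1.6 p. 10 / proof of Thm. 2.1 pp. 12–13 [cite: MochizukiGenEll2010, Thm 2.1 proof p.13]; support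
file for the route item `Summit.ABC.ABC.Theses.IUTThetaPilot.GenEllTwo` (stmt-ABC-19679), abc-iut-S6's
OWNER RULING #6 (family `t_c = 1/r + c·r^{k+1}/s`, `c ∈ ℚ^×`), W5 coordinator abc-iut-w5-d045.

The two W5 entry points for the W9 assembly —
`DeC.hconv_off_badPrimes` (abc-iut-w5-d054, `GenEllDeFamilyBadPrimesConverse.lean`) and
`DeC.slope_of_crit_off_badPrimes` (abc-iut-w5-d045, `GenEllDeFamilySlopeOffBadPrimes.lean`) — carry
three inputs about the critical values of `t_c`: a base number field `K` over which the critical-locus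
polynomial `R_c` SPLITS (`hsplit`), a finite `A ⊆ K` containing the critical values `t_c(Q_θ)`
(`hcritB`), and (for the slope) the converse `hconvA` itself.  This file discharges all three from the
`ℂ`-side data of `GenEllDeCriticalValuesFamily(Field).lean` (this seat): for `c ∈ ℚ^×`, an intermediate
field `ℚ ⊆ K ⊆ ℂ` finite-dimensional over `ℚ` containing the complex roots of `R_c` (such a `K` exists
and may be taken to contain any finite set of algebraic numbers: `DeCrit.exists_intermediateField_splits_RpolyC`),
and a finite `A ⊆ K` whose image in `ℂ` contains `DeCrit.critSetC k c`:

* `DeC.exists_field_and_critFinset` — such `(K, A)` exist, `K` containing any prescribed finite set of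
  algebraic numbers (e.g. the mechanism's `B`);
* `DeC.hconv_off_badPrimes_of_critSetC` — the converse off a finite set of primes `S(e, c)`, for every
  number field `L ⊇ K` and every point datum in the family normal forms (`c` read in `L` as `(c : L)`);
* `DeC.slope_of_critSetC` — the conductor slope
  `(1/[L:ℚ]) Σ_{w∈W} log N(w) ≤ ((|B|(2k+4) − (6k+6))/(2k+1))·(1/[L:ℚ])·h(x) + const` for every finite
  `B ⊇ A` with `t ∉ B`, from ONLY the point data, `hW`, and the analytic inputs
  `hbad₁/hbad₂/harch/htH/hNH/hBH` — i.e. W9's per-parameter call.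

Route note (F-w5d241-1 / S6's F3 ruling, 02:0x–02:3xZ): if the bad-place input `hbad₁` is produced
separation-free via the bounded-defect capstone (abc-iut-w5-d009 g2, `…_of_prime_defect`) instead of
`DeC.slope_of_crit_off_badPrimes`, the first theorem below is still THE `hconv` input of that capstone
(identical hypothesis shape at the good places); the second is the R-a″ composition of record.

Theorems only; classical; nothing here bears on [IUTchIII] Cor. 3.12.
-/

noncomputable section

namespace Literature.NumberTheory.DiophantineGeometry.GenEll

open _root_.Polynomial NumberField IsDedekindDomain
open Literature.IUT.LogVolume

/-- **The data `(K_c, A_c)` exists**: for `c ∈ ℚ` and any finite set `S ⊂ ℂ` of algebraic numbers there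
are an intermediate field `ℚ ⊆ K ⊆ ℂ`, finite-dimensional over `ℚ`, containing `S` and the complex roots
of `R_c`, and a finite `A ⊆ K` whose image in `ℂ` is EXACTLY `critSetC k c` — the inputs `K`, `hK`,
`A`, `hA` of the two theorems below. [cite: MochizukiGenEll2010, Thm 2.1 proof p.13] -/
theorem DeC.exists_field_and_critFinset (k : ℕ) (c : ℚ) (S : Set ℂ) (hSfin : S.Finite)
    (hS : ∀ x ∈ S, IsIntegral ℚ x) :
    ∃ K : IntermediateField ℚ ℂ, FiniteDimensional ℚ K ∧ S ⊆ (K : Set ℂ) ∧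
      (∀ θ : ℂ, (DeCrit.RpolyC k (c : ℂ)).eval θ = 0 → θ ∈ K) ∧
      ∃ A : Finset K, ((↑) : K → ℂ) '' ↑A = ↑(DeCrit.critSetC k c) := by
  obtain ⟨K, hfd, hSK, hK, hcrit, -⟩ := DeCrit.exists_intermediateField_splits_RpolyC k c S hSfin hS
  obtain ⟨A, hA⟩ := DeCrit.exists_finset_val_image_eq K (DeCrit.critSetC k c) hcrit
  exact ⟨K, hfd, hSK, hK, A, hA⟩

open scoped Classical in
/-- **The converse `hconv` for the family with the critical-value inputs discharged.**  For `c ∈ ℚ^×`,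
an intermediate field `K ⊆ ℂ` finite-dimensional over `ℚ` containing the complex roots of `R_c`, and a
finite `A ⊆ K` whose image contains `critSetC k c`: there is a finite set `S ∋ 2` of primes such that for
every number field `L ⊇ K`, every finite `T ⊇ S`, every finite place `w` of `L` not over `T` and every
point datum `(r, s, t, N)` in the family normal forms, `w(N) < 1 ⇒ ∃ a ∈ A, w(t − a) < 1`.
[cite: MochizukiGenEll2010, Thm 2.1 proof p.13] -/
theorem DeC.hconv_off_badPrimes_of_critSetC (k : ℕ) {c : ℚ} (hc : c ≠ 0)
    (K : IntermediateField ℚ ℂ) [FiniteDimensional ℚ K]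
    (hK : ∀ θ : ℂ, (DeCrit.RpolyC k (c : ℂ)).eval θ = 0 → θ ∈ K)
    (A : Finset K) (hA : ↑(DeCrit.critSetC k c) ⊆ ((↑) : K → ℂ) '' ↑A) :
    ∃ S : Finset ℕ, 2 ∈ S ∧ (∀ p ∈ S, p.Prime) ∧
      ∀ (L : Type) [Field L] [NumberField L] [Algebra K L] (T : Finset ℕ), S ⊆ T →
        ∀ (w : HeightOneSpectrum (𝓞 L)), w ∉ T.attach.biUnion (fun p => placesOver L p.1) →
        ∀ {r s t N : L},
        s ^ 2 = 1 - 4 * r ^ (2 * k + 1) → t * (r * s) = s + (c : L) * r ^ (k + 2) →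
        N = -s ^ 3 + (c : L) * ((k + 1) * r ^ (k + 2) - 2 * r ^ (3 * k + 3)) →
        w.valuation L N < 1 →
          ∃ a ∈ A.map ⟨algebraMap K L, (algebraMap K L).injective⟩, w.valuation L (t - a) < 1 := by
  haveI : NumberField K := NumberField.mk
  have hsplit : (DeCrit.RpolyC k ((c : ℚ) : K)).Splits :=
    DeCrit.splits_RpolyC_of_forall_root_mem_range K.val.toRingHom k c
      (fun θ hθ => ⟨⟨θ, hK θ hθ⟩, rfl⟩)
  have hcritB := DeCrit.forall_root_tC_mem_of_critSetC_subset_val_image (k := k) K hA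
  obtain ⟨S, h2, hp, hS⟩ :=
    DeC.hconv_off_badPrimes (K := K) k (c := (c : K)) (Rat.cast_ne_zero.mpr hc) A hsplit hcritB
  refine ⟨S, h2, hp, fun L _ _ _ T hST w hw r s t N hcurve ht hN hNlt => ?_⟩
  have hcL : algebraMap K L (c : K) = (c : L) := map_ratCast _ _
  exact hS L T hST w hw hcurve (by rw [hcL]; exact ht) (by rw [hcL]; exact hN) hNlt

open scoped Classical in
/-- **The conductor slope for the family with the critical-value inputs discharged** (W9's
per-parameter call): for `c ∈ ℚ^×`, `K ⊆ ℂ` finite-dimensional over `ℚ` containing the complex roots of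
`R_c`, and `A ⊆ K` finite with image `⊇ critSetC k c`, there is a finite set `S ∋ 2` of primes such that
for every number field `L ⊇ K`, every finite `T ⊇ S`, every point datum `(r, s, t, N, x)` in the family
normal forms with `N ≠ 0`, every finite `B ⊇ A` (read in `L`) with `t ∉ B`, every finite `W` of places
meeting `B` off `⋃_{p∈T} placesOver L p`, and the analytic inputs `hbad₁`, `hbad₂`, `harch`, `htH`, `hNH`,
`hBH`:
`(1/[L:ℚ]) Σ_{w∈W} log N(w) ≤ ((|B|(2k+4) − (6k+6))/(2k+1))·((1/[L:ℚ])·h(x)) + const` — the conclusion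
of `DeC.slope_of_crit_off_badPrimes` VERBATIM, with `hconvA` discharged by
`DeC.hconv_off_badPrimes_of_critSetC`. [cite: MochizukiGenEll2010, Thm 2.1 proof p.13] -/
theorem DeC.slope_of_critSetC (k : ℕ) {c : ℚ} (hc : c ≠ 0)
    (K : IntermediateField ℚ ℂ) [FiniteDimensional ℚ K]
    (hK : ∀ θ : ℂ, (DeCrit.RpolyC k (c : ℂ)).eval θ = 0 → θ ∈ K)
    (A : Finset K) (hA : ↑(DeCrit.critSetC k c) ⊆ ((↑) : K → ℂ) '' ↑A) :
    ∃ S : Finset ℕ, 2 ∈ S ∧ (∀ p ∈ S, p.Prime) ∧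
      ∀ (L : Type) [Field L] [NumberField L] [Algebra K L] (T : Finset ℕ), S ⊆ T →
        ∀ {r s t N x : L},
        s ^ 2 = 1 - 4 * r ^ (2 * k + 1) → t * (r * s) = s + (c : L) * r ^ (k + 2) →
        N = -s ^ 3 + (c : L) * ((k + 1) * r ^ (k + 2) - 2 * r ^ (3 * k + 3)) → N ≠ 0 →
        ∀ (B : Finset L), A.map ⟨algebraMap K L, (algebraMap K L).injective⟩ ⊆ B →
        (∀ b ∈ B, t ≠ b) →
        ∀ (W : Finset (HeightOneSpectrum (𝓞 L))) {C₁ C₂ C₃ C₄ C₅ C₆ : ℝ},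
        (∀ w ∈ W, w ∉ T.attach.biUnion (fun p => placesOver L p.1) → ∃ b ∈ B, 0 < ord L w (t - b)) →
        (∑ w ∈ T.attach.biUnion (fun p => placesOver L p.1),
            ((ord L w N).toNat : ℝ) * logNorm L w ≤ Module.finrank ℚ L * C₁) →
        (∑ w ∈ T.attach.biUnion (fun p => placesOver L p.1), logNorm L w ≤ Module.finrank ℚ L * C₂) →
        (∀ v : InfinitePlace L, Real.posLog (v N⁻¹) ≤ C₃) →
        ((2 * k + 1 : ℝ) * Height.logHeight₁ t ≤
          (2 * k + 4 : ℝ) * Height.logHeight₁ x + Module.finrank ℚ L * C₄) →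
        ((6 * k + 6 : ℝ) * Height.logHeight₁ x ≤
          (2 * k + 1 : ℝ) * Height.logHeight₁ N + Module.finrank ℚ L * C₅) →
        (∀ b ∈ B, Height.logHeight₁ b ≤ Module.finrank ℚ L * C₆) →
        (Module.finrank ℚ L : ℝ)⁻¹ * ∑ w ∈ W, logNorm L w ≤
          ((B.card * (2 * k + 4 : ℝ) - (6 * k + 6)) / (2 * k + 1)) *
              ((Module.finrank ℚ L : ℝ)⁻¹ * Height.logHeight₁ x) +
            ((B.card * C₄ + C₅) / (2 * k + 1) + B.card * (C₆ + Real.log 2) + C₁ + C₂ + C₃) := by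
  haveI : NumberField K := NumberField.mk
  obtain ⟨S₀, h2S₀, hS₀p, hS₀⟩ :=
    DeC.slope_of_crit_off_badPrimes (K := K) k (c := (c : K)) (Rat.cast_ne_zero.mpr hc) A
  obtain ⟨S₁, -, hS₁p, hS₁⟩ := DeC.hconv_off_badPrimes_of_critSetC k hc K hK A hA
  refine ⟨S₀ ∪ S₁, Finset.mem_union_left _ h2S₀, ?_, ?_⟩
  · intro p hp
    rcases Finset.mem_union.mp hp with h | h
    · exact hS₀p p h
    · exact hS₁p p h
  intro L _ _ _ T hST r s t N x hcurve ht hN hN0 B hAB htB W C₁ C₂ C₃ C₄ C₅ C₆ hW hbad₁ hbad₂ harch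
    htH hNH hBH
  have hS₀T : S₀ ⊆ T := fun p hp => hST (Finset.mem_union_left _ hp)
  have hS₁T : S₁ ⊆ T := fun p hp => hST (Finset.mem_union_right _ hp)
  have hcL : algebraMap K L (c : K) = (c : L) := map_ratCast _ _
  exact hS₀ L T hS₀T hcurve (by rw [hcL]; exact ht) (by rw [hcL]; exact hN) hN0 B hAB htB W
    (fun w hw hNlt => hS₁ L T hS₁T w hw hcurve ht hN hNlt) hW hbad₁ hbad₂ harch htH hNH hBH

end Literature.NumberTheory.DiophantineGeometry.GenEll

end
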